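import Mathlib
import Summits.Ventures.PercRepro2.ThreeTermPartLaw
import Summits.Ventures.PercRepro2.ThreeTermConeTransfer

/-!
# Three-terminal parts, VI: the pattern table is the partition table — row 2′TRI for core + part
from a certificate on the five-world table
(blind cell PercRepro2, night-3 g29, 2026-08-29; `proofs/NIGHT3-CERT.md` §38.10)

The part graph's pattern table `partTable` (ThreeTermPartLaw.lean) is indexed by the `8` patterns of
the three virtual edges, but two open virtual edges already join all three terminals, so the table is
constant on the fibres of `πpat` — **`partTable_rep`**: `partTable i j k = partTable (rep8 i) (rep8 j)
(rep8 k)` with `rep8` the representative pattern (`3, 5, 6 ↦ 7`).  The proof: `K₃` depends on the three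
configurations only through their connection relations (`K3_congr`), and a fibre configuration of a
pattern with two or three open virtual edges has the same connections as its overwrite by the full
merge (`conn_setOn_cfg7_iff`: every virtual edge's ends are connected already, `conn_virtual_of_two`).
Hence the table IS the `5³` partition table `partTable5 p q r = partTable (rep5 p) (rep5 q) (rep5 r)`,
and with `inConeP_cubicOf_of_inCone` (ThreeTermConeTransfer.lean):

* **`typedCount_part_nonneg_of_inCone5`**: if the five-world cubic of `partTable5` lies in
  `ThreeTerm.InCone` (the cone of g28's certlp.py / `ThreeTermHarrisCone.lean`) and the part's typed
  law satisfies typed Harris, the typed base of core + part is nonnegative — the certificate shape of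
  NIGHT3-CERT §37.5 feeds the part theorem directly.

Own work; standard axioms.
-/

namespace Summit.Ventures.PercRepro2

open SepPair Block ThreeTerm TypedStar

namespace Part

/-! ## The kernel `K₃` depends only on the connection relation -/

section Congr

variable {V : Type*} {E : Type*} {R : Type*} [Field R]

/-- Connection indicators agree on connection-equivalent configurations. -/
lemma indicator_connEvent_congr {ends : E → Sym2 V} {x x' : Config E}
    (hx : ∀ u v, Conn ends x u v ↔ Conn ends x' u v) (p q : V) :
    (connEvent ends p q).indicator (1 : Config E → R) x = (connEvent ends p q).indicator 1 x' := by
  refine indicator_one_eq_of_iff ?_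
  rw [mem_connEvent, mem_connEvent]
  exact hx p q

/-- The indicator of `Q` agrees on connection-equivalent configurations. -/
lemma indicator_avoidAll_congr {ends : E → Sym2 V} {x x' : Config E}
    (hx : ∀ u v, Conn ends x u v ↔ Conn ends x' u v) (a₁ a₂ : V) :
    (avoidAll ends a₂ {a₁}).indicator (1 : Config E → R) x = (avoidAll ends a₂ {a₁}).indicator 1 x' := by
  refine indicator_one_eq_of_iff ?_
  simp only [mem_avoidAll, Finset.mem_singleton, forall_eq]
  rw [hx a₂ a₁]

/-- The indicator of `PD` agrees on connection-equivalent configurations. -/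
lemma indicator_PDEvent_congr {ends : E → Sym2 V} {x x' : Config E}
    (hx : ∀ u v, Conn ends x u v ↔ Conn ends x' u v) (a₁ a₂ a₃ : V) :
    (PDEvent ends a₁ a₂ a₃).indicator (1 : Config E → R) x = (PDEvent ends a₁ a₂ a₃).indicator 1 x' := by
  refine indicator_one_eq_of_iff ?_
  simp only [PDEvent, Dtilde, UnionCluster.inU, Set.mem_inter_iff, Set.mem_compl_iff, Set.mem_union,
    mem_connEvent]
  rw [hx a₁ a₂, hx a₃ a₁, hx a₃ a₂]

/-- **`K₃` depends on the three configurations only through their connection relations.** -/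
theorem K3_congr {ends : E → Sym2 V} (o a₁ a₂ a₃ b : V) {x x' y y' w w' : Config E}
    (hx : ∀ u v, Conn ends x u v ↔ Conn ends x' u v) (hy : ∀ u v, Conn ends y u v ↔ Conn ends y' u v)
    (hw : ∀ u v, Conn ends w u v ↔ Conn ends w' u v) :
    CovForm.K3 (R := R) ends o a₁ a₂ a₃ b x y w = CovForm.K3 (R := R) ends o a₁ a₂ a₃ b x' y' w' := by
  unfold CovForm.K3 CovForm.sepKernel CovForm.f3 CovForm.f4 CovForm.f5 CovForm.f6 CovForm.f7 CovForm.f10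
    CovForm.f11 CovForm.f12 CovForm.sigma CovForm.inU CovForm.iQ CovForm.iPD CovForm.iL CovForm.iH
  simp only [Fin.sum_univ_succ, Fin.sum_univ_zero, Matrix.cons_val_zero, Matrix.cons_val_succ, add_zero,
    indicator_connEvent_congr hx, indicator_connEvent_congr hy, indicator_connEvent_congr hw,
    indicator_avoidAll_congr hx, indicator_avoidAll_congr hy, indicator_avoidAll_congr hw,
    indicator_PDEvent_congr hx, indicator_PDEvent_congr hy, indicator_PDEvent_congr hw]

end Congr

/-! ## The representative pattern -/

section Rep

/-- The representative of a pattern: two or three open virtual edges are the full merge `7`. -/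
def rep8 (i : Fin 8) : Fin 8 := if i.val = 3 ∨ i.val = 5 ∨ i.val = 6 ∨ i.val = 7 then 7 else i

/-- The representative pattern of a partition. -/
def rep5 (p : Fin 5) : Fin 8 := if p.val = 0 then 0 else if p.val = 1 then 1 else if p.val = 2 then 2
  else if p.val = 3 then 4 else 7

/-- `rep5 ∘ πpat = rep8`. -/
lemma rep5_πpat : ∀ i : Fin 8, rep5 (πpat i) = rep8 i := by decide

/-- A pattern is its own representative, or its representative is `7` and it has two or three bits. -/
lemma rep8_cases : ∀ i : Fin 8, rep8 i = i ∨ (rep8 i = 7 ∧ (i = 3 ∨ i = 5 ∨ i = 6 ∨ i = 7)) := by decide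

end Rep

/-! ## Fibre configurations of a pattern with two open virtual edges -/

section Fibre

variable {V : Type*} {E : Type*} [DecidableEq E]

/-- A fibre configuration of a star configuration is unchanged by re-overwriting it. -/
lemma setOn_cfg_self {S : Finset E} {e₁ e₂ e₃ : E} {x : Config E} (i : Fin 8)
    (hx : ∀ e ∈ S, x e = cfg e₁ e₂ e₃ i e) : setOn S (cfg e₁ e₂ e₃ i) x = x := by
  funext e
  by_cases he : e ∈ S
  · rw [setOn_of_mem he, hx e he]
  · rw [setOn_of_not_mem he]

variable {ends : E → Sym2 V} {S : Finset E} {e₁ e₂ e₃ : E} (h1 : e₁ ∈ S) (h2 : e₂ ∈ S) (h3 : e₃ ∈ S)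
  (h12 : e₁ ≠ e₂) (h13 : e₁ ≠ e₃) (h23 : e₂ ≠ e₃) {t₁ t₂ t₃ : V}

include h1 h2 h3 h12 h13 h23 in
/-- **The ends of every virtual edge are connected** in a fibre configuration of a pattern with two or
three open virtual edges. -/
lemma conn_virtual_of_two {x : Config E} {i : Fin 8} (hi : i = 3 ∨ i = 5 ∨ i = 6 ∨ i = 7)
    (hx : ∀ e ∈ S, x e = cfg e₁ e₂ e₃ i e) :
    Conn (partEnds ends (↑S) e₁ e₂ e₃ t₁ t₂ t₃) x t₁ t₂ ∧
    Conn (partEnds ends (↑S) e₁ e₂ e₃ t₁ t₂ t₃) x t₁ t₃ ∧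
    Conn (partEnds ends (↑S) e₁ e₂ e₃ t₁ t₂ t₃) x t₂ t₃ := by
  have hx1 : x e₁ = decide (bit 0 i = 1) := by rw [hx e₁ h1, cfg_s0]
  have hx2 : x e₂ = decide (bit 1 i = 1) := by rw [hx e₂ h2, cfg_s1 e₁ e₂ e₃ h12]
  have hx3 : x e₃ = decide (bit 2 i = 1) := by rw [hx e₃ h3, cfg_s2 e₁ e₂ e₃ h13 h23]
  have c1 : x e₁ = true → Conn (partEnds ends (↑S) e₁ e₂ e₃ t₁ t₂ t₃) x t₁ t₂ := fun h =>
    conn_of_openAdj ⟨e₁, h, partEnds_apply_1 ends (↑S) t₁ t₂ t₃⟩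
  have c2 : x e₂ = true → Conn (partEnds ends (↑S) e₁ e₂ e₃ t₁ t₂ t₃) x t₁ t₃ := fun h =>
    conn_of_openAdj ⟨e₂, h, partEnds_apply_2 ends (↑S) t₁ t₂ t₃ h12⟩
  have c3 : x e₃ = true → Conn (partEnds ends (↑S) e₁ e₂ e₃ t₁ t₂ t₃) x t₂ t₃ := fun h =>
    conn_of_openAdj ⟨e₃, h, partEnds_apply_3 ends (↑S) t₁ t₂ t₃ h13 h23⟩
  rcases hi with rfl | rfl | rfl | rfl
  · -- `3`: `e₁, e₂` open
    have a1 := c1 (by rw [hx1]; decide)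
    have a2 := c2 (by rw [hx2]; decide)
    exact ⟨a1, a2, conn_trans (conn_symm a1) a2⟩
  · -- `5`: `e₁, e₃` open
    have a1 := c1 (by rw [hx1]; decide)
    have a3 := c3 (by rw [hx3]; decide)
    exact ⟨a1, conn_trans a1 a3, a3⟩
  · -- `6`: `e₂, e₃` open
    have a2 := c2 (by rw [hx2]; decide)
    have a3 := c3 (by rw [hx3]; decide)
    exact ⟨conn_trans a2 (conn_symm a3), a2, a3⟩
  · -- `7`: all open
    exact ⟨c1 (by rw [hx1]; decide), c2 (by rw [hx2]; decide), c3 (by rw [hx3]; decide)⟩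

include h1 h2 h3 h12 h13 h23 in
/-- **Overwriting by the full merge is invisible to connections** on a fibre configuration of a pattern
with two or three open virtual edges. -/
lemma conn_setOn_cfg7_iff {x : Config E} {i : Fin 8} (hi : i = 3 ∨ i = 5 ∨ i = 6 ∨ i = 7)
    (hx : ∀ e ∈ S, x e = cfg e₁ e₂ e₃ i e) (u v : V) :
    Conn (partEnds ends (↑S) e₁ e₂ e₃ t₁ t₂ t₃) x u v ↔
      Conn (partEnds ends (↑S) e₁ e₂ e₃ t₁ t₂ t₃) (setOn S (cfg e₁ e₂ e₃ 7) x) u v := by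
  obtain ⟨a1, a2, a3⟩ := conn_virtual_of_two (ends := ends) (t₁ := t₁) (t₂ := t₂) (t₃ := t₃)
    h1 h2 h3 h12 h13 h23 hi hx
  have c71 : cfg e₁ e₂ e₃ 7 e₁ = true := by rw [cfg_s0]; simp [bit]
  have c72 : cfg e₁ e₂ e₃ 7 e₂ = true := by rw [cfg_s1 e₁ e₂ e₃ h12]; simp [bit]
  have c73 : cfg e₁ e₂ e₃ 7 e₃ = true := by rw [cfg_s2 e₁ e₂ e₃ h13 h23]; simp [bit]
  constructor
  · -- the overwrite is larger
    refine conn_mono (fun e => ?_)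
    by_cases he : e ∈ S
    · rw [setOn_of_mem he, hx e he]
      cases h : cfg e₁ e₂ e₃ i e
      · exact Bool.false_le _
      · have hstar := suppOn_cfg e₁ e₂ e₃ i e h
        simp only [Finset.mem_insert, Finset.mem_singleton] at hstar
        rcases hstar with h' | h' | h'
        · rw [h', c71]
        · rw [h', c72]
        · rw [h', c73]
    · rw [setOn_of_not_mem he]
  · -- closure: every open edge of the overwrite joins vertices already connected in `x`
    intro h
    refine mem_of_conn_of_closed' (S := {z | Conn (partEnds ends (↑S) e₁ e₂ e₃ t₁ t₂ t₃) x u z}) ?_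
      (conn_refl _ _ _) h
    intro f a b hf hab ha
    by_cases hf1 : f = e₁
    · subst hf1
      rw [partEnds_apply_1, Sym2.eq_iff] at hab
      rcases hab with ⟨rfl, rfl⟩ | ⟨rfl, rfl⟩
      · exact conn_trans ha a1
      · exact conn_trans ha (conn_symm a1)
    by_cases hf2 : f = e₂
    · subst hf2
      rw [partEnds_apply_2 ends (↑S) t₁ t₂ t₃ h12, Sym2.eq_iff] at hab
      rcases hab with ⟨rfl, rfl⟩ | ⟨rfl, rfl⟩
      · exact conn_trans ha a2
      · exact conn_trans ha (conn_symm a2)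
    by_cases hf3 : f = e₃
    · subst hf3
      rw [partEnds_apply_3 ends (↑S) t₁ t₂ t₃ h13 h23, Sym2.eq_iff] at hab
      rcases hab with ⟨rfl, rfl⟩ | ⟨rfl, rfl⟩
      · exact conn_trans ha a3
      · exact conn_trans ha (conn_symm a3)
    by_cases hfS : f ∈ S
    · rw [setOn_of_mem hfS, cfg_other e₁ e₂ e₃ 7 hf1 hf2 hf3] at hf
      exact absurd hf Bool.false_ne_true
    · rw [setOn_of_not_mem hfS] at hf
      exact conn_trans ha (conn_of_openAdj ⟨f, hf, hab⟩)

include h1 h2 h3 h12 h13 h23 in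
/-- A fibre configuration of a pattern and its overwrite by the representative pattern have the same
connections. -/
lemma conn_rep_iff {x : Config E} (i : Fin 8) (hx : ∀ e ∈ S, x e = cfg e₁ e₂ e₃ i e) (u v : V) :
    Conn (partEnds ends (↑S) e₁ e₂ e₃ t₁ t₂ t₃) x u v ↔
      Conn (partEnds ends (↑S) e₁ e₂ e₃ t₁ t₂ t₃) (setOn S (cfg e₁ e₂ e₃ (rep8 i)) x) u v := by
  rcases rep8_cases i with hr | ⟨hr, hi⟩
  · rw [hr, setOn_cfg_self i hx]
  · rw [hr]
    exact conn_setOn_cfg7_iff h1 h2 h3 h12 h13 h23 hi hx u v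

end Fibre

/-! ## The pattern table is the partition table -/

section Table

variable {V : Type*} {E : Type*} [Fintype E] [DecidableEq E]

/-- **The pattern table is constant on the fibres of `πpat`.** -/
theorem partTable_rep (ends : E → Sym2 V) (S : Finset E) {e₁ e₂ e₃ : E} (h1 : e₁ ∈ S) (h2 : e₂ ∈ S)
    (h3 : e₃ ∈ S) (h12 : e₁ ≠ e₂) (h13 : e₁ ≠ e₃) (h23 : e₂ ≠ e₃) (t₁ t₂ t₃ o a₁ a₂ a₃ b : V)
    {F : Finset E} (hd : Disjoint F S) (z : Config E) (τ : E → ℕ) (i j k : Fin 8) :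
    partTable ends S e₁ e₂ e₃ t₁ t₂ t₃ o a₁ a₂ a₃ b F z τ i j k =
      partTable ends S e₁ e₂ e₃ t₁ t₂ t₃ o a₁ a₂ a₃ b F z τ (rep8 i) (rep8 j) (rep8 k) := by
  unfold partTable
  refine typedCount3_setOn_eq hd z τ _ _ _ _ _ _ _ _ fun x y w hx hy hw => ?_
  have fib : ∀ (l : Fin 8) (x : Config E), (∀ e, e ∉ F → x e = setOn S (cfg e₁ e₂ e₃ l) z e) →
      ∀ e ∈ S, x e = cfg e₁ e₂ e₃ l e := by
    intro l x hx e he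
    have heF : e ∉ F := fun hF => Finset.disjoint_left.mp hd hF he
    rw [hx e heF, setOn_of_mem he]
  exact K3_congr o a₁ a₂ a₃ b (conn_rep_iff h1 h2 h3 h12 h13 h23 i (fib i x hx))
    (conn_rep_iff h1 h2 h3 h12 h13 h23 j (fib j y hy)) (conn_rep_iff h1 h2 h3 h12 h13 h23 k (fib k w hw))

/-- **The five-world (partition) table** of the part graph: the pattern table at the representative
patterns. -/
noncomputable def partTable5 (ends : E → Sym2 V) (S : Finset E) (e₁ e₂ e₃ : E) (t₁ t₂ t₃ : V)
    (o a₁ a₂ a₃ b : V) (F : Finset E) (z : Config E) (τ : E → ℕ) (p q r : Fin 5) : ℚ :=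
  partTable ends S e₁ e₂ e₃ t₁ t₂ t₃ o a₁ a₂ a₃ b F z τ (rep5 p) (rep5 q) (rep5 r)

/-- The pattern table is the pull-back of the partition table along `πpat`. -/
lemma partTable_eq_partTable5 (ends : E → Sym2 V) (S : Finset E) {e₁ e₂ e₃ : E} (h1 : e₁ ∈ S)
    (h2 : e₂ ∈ S) (h3 : e₃ ∈ S) (h12 : e₁ ≠ e₂) (h13 : e₁ ≠ e₃) (h23 : e₂ ≠ e₃)
    (t₁ t₂ t₃ o a₁ a₂ a₃ b : V) {F : Finset E} (hd : Disjoint F S) (z : Config E) (τ : E → ℕ)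
    (i j k : Fin 8) :
    partTable ends S e₁ e₂ e₃ t₁ t₂ t₃ o a₁ a₂ a₃ b F z τ i j k =
      partTable5 ends S e₁ e₂ e₃ t₁ t₂ t₃ o a₁ a₂ a₃ b F z τ (πpat i) (πpat j) (πpat k) := by
  unfold partTable5
  rw [rep5_πpat, rep5_πpat, rep5_πpat]
  exact partTable_rep ends S h1 h2 h3 h12 h13 h23 t₁ t₂ t₃ o a₁ a₂ a₃ b hd z τ i j k

/-- **Row 2′TRI for core + part from a certificate on the partition table**: if the five-world cubic
of the part graph's partition table lies in the Harris cone and the part's typed law satisfies typed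
Harris, the typed base of core + part is nonnegative. -/
theorem typedCount_part_nonneg_of_inCone5 {ends : E → Sym2 V} {W : Set V} {t₁ t₂ t₃ : V}
    (hW : IsPart ends W t₁ t₂ t₃) {S : Finset E} (hS : ∀ e, e ∈ S ↔ e ∈ touches ends W)
    {e₁ e₂ e₃ : E} (h1 : e₁ ∈ S) (h2 : e₂ ∈ S) (h3 : e₃ ∈ S) (h12 : e₁ ≠ e₂) (h13 : e₁ ≠ e₃)
    (h23 : e₂ ≠ e₃) {o a₁ a₂ a₃ b : V} (ho : o ∉ W) (ha₁ : a₁ ∉ W) (ha₂ : a₂ ∉ W) (ha₃ : a₃ ∉ W)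
    (hb : b ∉ W) {F : Finset E} (hd : Disjoint F S) (z : Config E) (τ : E → ℕ)
    (hcone : InCone (fun ν => ∑ p : Fin 5, ∑ q : Fin 5, ∑ r : Fin 5,
      partTable5 ends S e₁ e₂ e₃ t₁ t₂ t₃ o a₁ a₂ a₃ b F z τ p q r * mono p q r ν))
    (hH : TypedHarris πpat (partLaw S τ (pat ends S e₁ e₂ e₃ t₁ t₂ t₃))) :
    0 ≤ typedCount (F ∪ S) z τ (CovForm.K3 (R := ℚ) ends o a₁ a₂ a₃ b) :=
  typedCount_part_nonneg hW hS h1 h2 h3 h12 h13 h23 ho ha₁ ha₂ ha₃ hb hd z τ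
    (inConeP_cubicOf_of_inCone πpat _ _
      (partTable_eq_partTable5 ends S h1 h2 h3 h12 h13 h23 t₁ t₂ t₃ o a₁ a₂ a₃ b hd z τ) hcone) hH

end Table

end Part

end Summit.Ventures.PercRepro2
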